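import Summits.NavierStokesRegularity.NavierStokesRegularity.Theorems.ExtremiserTransienceNearExtremalTransienceExtremiserLiouvilleConstantSpeedExampleFarField
import Literature.Analysis.FluidPDE.CurlIsometryCovariance
import HarnessLib

/-!
# Crux `ExtremiserTransience.NearExtremalTransience` (stmt-NavierStokesRegularity-21883), line `extremiser_liouville`,
# stub K1b — THE EXPLICIT CONSTANT-SPEED FIELD HAS ZERO VORTEX STRETCHING: `S = ∫⟪ω, Dv ω⟫ = 0`

`--supports stmt-NavierStokesRegularity-21883` (helper).  Author: prover seat `ns-el-k1b` (g4).  Sequel of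
`…ConstantSpeedExample`.

The explicit field `v` is ANTI-INVARIANT under the rotation by `π` about the `x₀`-axis, `P(x₀,x₁,x₂) = (x₀,−x₁,−x₂)` (a linear
isometry, `P = P⁻¹`): **`v(Px) = −P v(x)`** (`field_halfTurn`; the radial coefficient `fc` is odd in `x₂`, the swirl `gc` and the
axial deficit `hc` are even).  Hence the conjugated field `P ∘ v ∘ P⁻¹` is `−v` (`conj_halfTurn_eq_neg`).  The stretching
functional `S(w) = ∫⟪curl w, Dw (curl w)⟫` is invariant under isometric conjugation (pseudovector law
`curl(P∘v∘P⁻¹) = det P · P curl v ∘ P⁻¹`, `det P = ±1`, `Literature…curl_conj_linearIsometryEquiv`; chain rule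
`fderiv_conj_linearIsometryEquiv`; `P⁻¹` preserves Lebesgue measure) and ODD under `w ↦ −w`, so
**`stretching_field_eq_zero : ∫⟪curl v, Dv (curl v)⟫ = 0`**: the example is as far from `κ⋆`-efficient as a field can be — it
witnesses the non-emptiness of the SOFT residue class only, not a failure of K1b.

WHAT THIS IS NOT: not a counterexample to K1b; K1b is NOT proved; nothing here proves NS regularity. [folklore]
-/

noncomputable section

open Set Filter Topology MeasureTheory Metric Function
open scoped ENNReal NNReal Topology InnerProductSpace RealInnerProductSpace ContDiff
open Literature.Analysis.FluidPDE Literature.Analysis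

namespace Summit.NavierStokesRegularity.NavierStokesRegularity.Theorems

-- the problem directory repeats the summit name (`NavierStokesRegularity/NavierStokesRegularity`)
set_option linter.dupNamespace false

namespace ExtremiserLiouville

namespace ConstantSpeedExample

/-! ## The half-turn about the `x₀`-axis -/

/-- The half-turn `P(x₀,x₁,x₂) = (x₀,−x₁,−x₂)` as a linear equivalence (its own inverse). [folklore] -/
def halfTurnLinearEquiv : EuclideanSpace ℝ (Fin 3) ≃ₗ[ℝ] EuclideanSpace ℝ (Fin 3) where
  toFun x := WithLp.toLp 2 ![x 0, -x 1, -x 2]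
  invFun x := WithLp.toLp 2 ![x 0, -x 1, -x 2]
  map_add' x y := by ext i; fin_cases i <;> simp <;> ring
  map_smul' a x := by ext i; fin_cases i <;> simp
  left_inv x := by ext i; fin_cases i <;> simp
  right_inv x := by ext i; fin_cases i <;> simp

/-- The half-turn `P` as a linear isometry of `ℝ³`. [folklore] -/
def halfTurn : EuclideanSpace ℝ (Fin 3) ≃ₗᵢ[ℝ] EuclideanSpace ℝ (Fin 3) :=
  { halfTurnLinearEquiv with
    norm_map' := fun x => by
      change ‖(WithLp.toLp 2 ![x 0, -x 1, -x 2] : EuclideanSpace ℝ (Fin 3))‖ = ‖x‖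
      rw [EuclideanSpace.norm_eq, EuclideanSpace.norm_eq]
      congr 1
      simp [Fin.sum_univ_three] }

/-- Coordinates of `P x`. [folklore] -/
@[simp] theorem halfTurn_apply_zero (x : EuclideanSpace ℝ (Fin 3)) : halfTurn x 0 = x 0 := rfl
/-- Coordinates of `P x`. [folklore] -/
@[simp] theorem halfTurn_apply_one (x : EuclideanSpace ℝ (Fin 3)) : halfTurn x 1 = -x 1 := rfl
/-- Coordinates of `P x`. [folklore] -/
@[simp] theorem halfTurn_apply_two (x : EuclideanSpace ℝ (Fin 3)) : halfTurn x 2 = -x 2 := rfl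
/-- `P⁻¹ = P`. [folklore] -/
@[simp] theorem halfTurn_symm_apply (x : EuclideanSpace ℝ (Fin 3)) : halfTurn.symm x = halfTurn x := rfl

/-! ## Parity of the building blocks and anti-invariance of the field -/

/-- `u, b, Q, N, gc, hc` are even and `fc` is odd under the half-turn. [folklore] -/
theorem blocks_halfTurn (x : EuclideanSpace ℝ (Fin 3)) :
    uu (halfTurn x) = uu x ∧ bb (halfTurn x) = bb x ∧ QQ (halfTurn x) = QQ x ∧ NN (halfTurn x) = NN x ∧
      fc (halfTurn x) = -fc x ∧ gc (halfTurn x) = gc x ∧ hc (halfTurn x) = hc x := by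
  have hu : uu (halfTurn x) = uu x := by simp [uu]
  have hb : bb (halfTurn x) = bb x := by simp [bb]
  have hQ : QQ (halfTurn x) = QQ x := by simp only [QQ, hu, hb]
  have hN : NN (halfTurn x) = NN x := by simp only [NN, hu, hb, hQ, halfTurn_apply_two, neg_sq]
  refine ⟨hu, hb, hQ, hN, ?_, ?_, ?_⟩
  · simp only [fc, hu, hQ, halfTurn_apply_two]; ring
  · simp only [gc, hN, hQ]
  · simp only [hc, hu, hb, hQ]

/-- **Anti-invariance**: `v(Px) = −P v(x)`. [folklore] -/
theorem field_halfTurn (x : EuclideanSpace ℝ (Fin 3)) : field (halfTurn x) = -halfTurn (field x) := by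
  obtain ⟨-, -, -, -, hf, hg, hh⟩ := blocks_halfTurn x
  ext i
  fin_cases i
  · simp [field_apply_zero, hf, hg]; ring
  · simp [field_apply_one, hf, hg]
  · simp [field_apply_two, hh]

/-- The conjugated field `P ∘ v ∘ P⁻¹` is `−v`. [folklore] -/
theorem conj_halfTurn_eq_neg : (fun y => halfTurn (field (halfTurn.symm y))) = fun y => -field y := by
  funext y
  rw [halfTurn_symm_apply, field_halfTurn, map_neg]
  congr 1
  exact halfTurn.apply_symm_apply (field y)

/-! ## Zero stretching -/

/-- The stretching density of a conjugated field is the transported density: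
`⟪curl w, Dw curl w⟫(x) = ⟪curl v, Dv curl v⟫(P⁻¹x)` for `w = P ∘ v ∘ P⁻¹` (any linear isometry `P`, `det² = 1`).
[folklore] -/
theorem stretchingDensity_conj (R : EuclideanSpace ℝ (Fin 3) ≃ₗᵢ[ℝ] EuclideanSpace ℝ (Fin 3))
    (w : EuclideanSpace ℝ (Fin 3) → EuclideanSpace ℝ (Fin 3)) (x : EuclideanSpace ℝ (Fin 3)) :
    ⟪curl (fun y => R (w (R.symm y))) x, fderiv ℝ (fun y => R (w (R.symm y))) x (curl (fun y => R (w (R.symm y))) x)⟫ =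
      ⟪curl w (R.symm x), fderiv ℝ w (R.symm x) (curl w (R.symm x))⟫ := by
  rw [curl_conj_linearIsometryEquiv, fderiv_conj_linearIsometryEquiv]
  set d : ℝ := (R : EuclideanSpace ℝ (Fin 3) →L[ℝ] EuclideanSpace ℝ (Fin 3)).det
  have hd : d * d = 1 := det_linearIsometryEquiv_mul_self R
  simp only [ContinuousLinearMap.comp_apply, map_smul, inner_smul_left, inner_smul_right, RCLike.conj_to_real]
  rw [show ((R.symm : EuclideanSpace ℝ (Fin 3) →L[ℝ] EuclideanSpace ℝ (Fin 3)) (R (curl w (R.symm x)))) =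
      curl w (R.symm x) from R.symm_apply_apply _]
  rw [show ((R : EuclideanSpace ℝ (Fin 3) →L[ℝ] EuclideanSpace ℝ (Fin 3)) (fderiv ℝ w (R.symm x) (curl w (R.symm x)))) =
      R (fderiv ℝ w (R.symm x) (curl w (R.symm x))) from rfl, LinearIsometryEquiv.inner_map_map]
  rw [← mul_assoc, hd, one_mul]

/-- The stretching density of `−w` is minus that of `w`. [folklore] -/
theorem stretchingDensity_neg (w : EuclideanSpace ℝ (Fin 3) → EuclideanSpace ℝ (Fin 3)) (x : EuclideanSpace ℝ (Fin 3)) :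
    ⟪curl (fun y => -w y) x, fderiv ℝ (fun y => -w y) x (curl (fun y => -w y) x)⟫ =
      -⟪curl w x, fderiv ℝ w x (curl w x)⟫ := by
  rw [curl_neg, fderiv_fun_neg]
  simp [inner_neg_left]

/-- **The example has zero vortex stretching: `S(v) = ∫⟪curl v, Dv curl v⟫ = 0`.** [folklore] -/
theorem stretching_field_eq_zero : ∫ x, ⟪curl field x, fderiv ℝ field x (curl field x)⟫ = 0 := by
  set s : EuclideanSpace ℝ (Fin 3) → ℝ := fun x => ⟪curl field x, fderiv ℝ field x (curl field x)⟫ with hs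
  -- `S(P ∘ v ∘ P⁻¹) = S(v)` by the change of variables `x ↦ P⁻¹ x`
  have hconj : (∫ x, ⟪curl (fun y => halfTurn (field (halfTurn.symm y))) x,
      fderiv ℝ (fun y => halfTurn (field (halfTurn.symm y))) x (curl (fun y => halfTurn (field (halfTurn.symm y))) x)⟫) =
      ∫ x, s x := by
    simp_rw [stretchingDensity_conj]
    exact halfTurn.symm.measurePreserving.integral_comp halfTurn.symm.toHomeomorph.measurableEmbedding s
  -- `S(−v) = −S(v)`
  have hneg : (∫ x, ⟪curl (fun y => -field y) x, fderiv ℝ (fun y => -field y) x (curl (fun y => -field y) x)⟫) =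
      -∫ x, s x := by
    simp_rw [stretchingDensity_neg]
    rw [integral_neg]
  rw [conj_halfTurn_eq_neg] at hconj
  rw [hconj] at hneg
  show (∫ x, s x) = 0
  linarith

end ConstantSpeedExample

end ExtremiserLiouville

end Summit.NavierStokesRegularity.NavierStokesRegularity.Theorems

end
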